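import Literature.NumberTheory.EllipticCurves.KellerYin2024.CharacterSelmerGroups
import HarnessLib

/-!
# Keller–Yin Lemma 1.1.1 / Castella–Grossi–Lee–Skinner Lemma 1.1.1: the `λ`-invariants of the
# ANTICYCLOTOMIC local Euler factors `𝒫_w(θ)`, `𝒫_w(f) ∈ Λ` at a split prime `w ∤ p` — DEFINITIONS ONLY

Cell `bsd-eis` (FULL-BSD rank ≤ 1 programme, home `run/shared/lean/pub/bsd-eis/`), seat `bsd-eis-k5-ty`
(D-0074 group (C) row E (i), definition D3 of LIT-DOSSIER §35 (B)/(B′) and §36 (B)–(C)): the third of the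
Literature DEFINITIONS commissioned for the kernel attack on the K5 crux-2 residue
`X1.KellerYinIMC2Halves.GoodLatticeMuLambdaOnTree` (D1/D2 = `KellerYin2024/CharacterSelmerGroups.lean`,
D4 = `CastellaGrossiLeeSkinner2022/KatzPAdicLFunctionFrame.lean`). DEFINITIONS AND PROVED LEMMAS ONLY:
no named fact, nothing asserted (D-0026).

## What is printed

Keller–Yin, arXiv:2402.12781v2, §1.1.1, **Lemma 1.1.1** (TeX label `H1 Euler`, L455–462; PDF p. 9),
for a character `θ : G_K → 𝔽^× ↪ 𝓞^×` and a place `w ∣ ℓ` of `K`, `w ∤ p`, `w` SPLIT in `K`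
(standing: `Frob_w ∈ G_w/I_w` the ARITHMETIC Frobenius, L383; `Γ = Gal(K_∞/K)` anticyclotomic,
`Λ = 𝓞⟦Γ⟧ = 𝓞⟦T⟧`, `T = γ − 1`, L385):

> "Let `γ_w` be the image of `Frob_w` in the decomposition group of `w ∣ ℓ`. Let
> `𝒫_w(θ) = P_w(ℓ⁻¹γ_w) ∈ Λ` with `P_w := det(1 − Frob_w X ∣ F(θ)_{I_w})` the Euler factor at `w` of
> the `L`-function of `θ`. The module `H¹(K_w, M_θ)^∨` is `Λ`-torsion with characteristic ideal
> `(𝒫_w(θ))`. In particular, it has `μ`-invariant `0`." (Proof: "See [CGLS, Lemma 1.1.1]. Note that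
> their proof works for any `θ`.")

and, for the newform `f` (§1.5, L1337–1341): "`𝒫_w(f) := P_w(ℓ⁻¹γ_w) ∈ Λ` with
`P_w = det(1 − Frob_w X ∣ V_{f,I_w})`". Castella–Grossi–Lee–Skinner, Invent. Math. 227 (2022),
Lemma 1.1.1 (§1.1.1 "`w ∤ p` split in `K`") is the same statement for `θ|_{G_{v̄}} ∉ {1, ω}` and
`𝒫_w(E)`. The cyclotomic template over `ℚ_∞` is Greenberg–Vatsal, Invent. Math. 142 (2000),
Prop. (2.4): "`𝓗_ℓ(ℚ_∞)^` has `λ`-invariant `s_ℓ d_ℓ`", `s_ℓ` = number of primes of `ℚ_∞` above `ℓ`,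
`d_ℓ` = multiplicity of `X = ℓ̃⁻¹` as a root of `P̃_ℓ(X)` — the tree's `GreenbergVatsal2000.sFactor`,
`dMultiplicity`, `delta`.

## What the consumers need, and what is therefore defined

KY Prop. 1.2.5 (L780), Thm. 1.5.1 (`algmain`, L1346) and Thm. 2.2.2 (`anacong`, L1445) consume ONLY
the NUMBERS `λ(𝒫_w(θ))`, `λ(𝒫_w(f)) ∈ ℕ`, never the `Λ`-elements. With `γ_w = γ^{a_w}`,
`a_w ∈ ℤ_p ∖ {0}` (`w` split in `K` ⇒ finitely decomposed in `K_∞`, KY Lemma 1.0.1), and `θ` of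
finite prime-to-`p` order unramified at `w`, `𝒫_w(θ) = 1 − θ(Frob_w)ℓ⁻¹(1+T)^{a_w}` has `μ = 0`
and
  `λ(𝒫_w(θ)) = [Γ : Γ_w] · 𝟙[θ(Frob_w) ≡ ℓ (mod 𝔭)]`,
`[Γ : Γ_w] = p^{ord_p a_w}` = the number of places of `K_∞` above `w` (reduce mod `𝔭`:
`1 − ū(1+T)^{p^e a'} ≡ (1 − ū) − ū a' T^{p^e} + …`); likewise `λ(𝒫_w(f)) = [Γ : Γ_w] ·
(multiplicity of `X = ℓ̃⁻¹` as a root of `P̃_w(X) ∈ 𝔽[X]`)` (eigenvalue by eigenvalue; for `f = f_E`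
of weight `2`, `P_w = 1 − a_ℓ X + ℓ X²` at good `ℓ`, `1 ∓ X` at multiplicative `ℓ` — Mathlib's
`WeierstrassCurve.localPolynomialAt`, already reduced mod `p` by the tree as
`GreenbergVatsal2000.eulerFactorModP`). This is the GV Prop. (2.4) recipe with the cyclotomic
`s_ℓ` replaced by the anticyclotomic `[Γ : Γ_w]`, which has NO closed formula in `ℓ` (it is the
`p`-part of the order of `w` in the ring-class tower) and is therefore defined from the tower datum
`κ : ZpExtension K p` itself: `[ℤ_p : κ(D_w)]` for the tree's decomposition group
`GreenbergSelmer.decomp w` (well defined: `Γ` is abelian). Both invariants are unchanged by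
`γ ↦ γ⁻¹` (CGLS, proof of Thm. 2.2.2: "the involution … preserves `λ`-invariants"), so no
orientation of `γ` enters.

## Contents (all in `namespace Literature.NumberTheory.EllipticCurves.KellerYin2024`)

* `numPlacesAbove κ w : ℕ` — `[Γ : Γ_w]`, the number of places of `K_∞ = K̄^{ker κ}` above `w`
  (junk `0` when `w` splits completely, i.e. `κ(D_w) = 1`, which for the anticyclotomic tower
  happens exactly at the places inert or ramified over `ℚ`, KY Lemma 1.0.1 — never at the split
  `w` the consumers quantify over).
* `FrobActsAsNormAt S θ w : Prop` — "`θ` is unramified at `w` and `θ(Frob_w) ≡ Nw (mod 𝔭)`"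
  for a character `θ : Γ_K → GL₁(𝒪)`, `𝒪 = 𝒪_{ℚ_p(S)} ⊆ ℚ̄_p` (the coefficient ring of
  `CharacterSelmerGroups.lean` §3), arithmetic Frobenius (Mathlib `IsArithFrobAt`, via the tree's
  `FramedGaloisRep.HasFrobCharpolyAt`), `Nw = #𝓞_K/w` (`= ℓ` for `w` split).
* `charLocalLambda S κ θ w : ℕ` — `λ(𝒫_w(θ))`.
* `curveLocalLambda κ W w : ℕ` — `λ(𝒫_w(f_E))` for `W : WeierstrassCurve K` (use `W.baseChange K`
  for `E/ℚ`), via `GreenbergVatsal2000.eulerFactorModP`.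
* unfolding / bound lemmas (`charLocalLambda_le`, `charLocalLambda_of_frobActsAsNormAt`,
  `charLocalLambda_of_not_frobActsAsNormAt`, `curveLocalLambda_eq`).

What is NOT here: the `Λ`-elements `𝒫_w(θ)`, `𝒫_w(f)` themselves (no consumer needs them; they
would require the `(1+T)^{a}`, `a ∈ ℤ_p`, calculus), and the THEOREM "char `H¹(K_w, M_θ)^∨ =
(𝒫_w(θ))`" (KY/CGLS Lemma 1.1.1) — a statement for the typer's PRE/PUB files, not asserted here.

## References
* [KellerYin2024] T. Keller, M. Yin, arXiv:2402.12781v2, Lemma 1.1.1 (`H1 Euler`, L455–462, p. 9),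
  Lemma 1.0.1 (L388), §1.5 L1337–1341 (`𝒫_w(f)`), Prop. 1.2.5, Thm. 1.5.1, Thm. 2.2.2.
* [CastellaGrossiLeeSkinner2022] Invent. Math. 227 (2022), Lemma 1.1.1; proof of Thm. 2.2.2.
* [GreenbergVatsal2000] Invent. Math. 142 (2000), Prop. (2.4) (p. 22) and p. 30 (`s_ℓ`, `d_ℓ`).
* [Greenberg1989] §1 p. 98 (decomposition groups for the chosen embedding).
-/

noncomputable section

open scoped Classical

open NumberField IsDedekindDomain Field Polynomial
open Literature.NumberTheory.EllipticCurves Literature.NumberTheory.EllipticCurves.GreenbergSelmer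
open Literature.NumberTheory.GaloisRepresentations

namespace Literature.NumberTheory.EllipticCurves.KellerYin2024

/-! ## §1 `[Γ : Γ_w]` — the number of places of `K_∞` above `w` -/

section Places

variable {K : Type} [Field K] [NumberField K] {p : ℕ} [Fact p.Prime]

/-- **`[Γ : Γ_w]`, the number of places of the `ℤ_p`-extension `K_∞ = K̄^{ker κ}` above the finite
place `w` of `K`**: the index in `Γ = Gal(K_∞/K) ≅ ℤ_p` (via `κ`) of the decomposition group
`Γ_w` = image of `D_w ≤ Γ_K` (the tree's `GreenbergSelmer.decomp w`; `Γ` abelian, so independent of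
the prime of `K̄` above `w`). A power of `p` when `w` is finitely decomposed; Mathlib's junk value
`0` (`Subgroup.index` of an infinite-index subgroup) when `w` splits completely in `K_∞` — for the
ANTICYCLOTOMIC tower exactly the places over primes inert or ramified in `K/ℚ` (KY Lemma 1.0.1:
"If `ℓ` is unramified and split in `K`, there are only finitely many primes of `K_∞` lying above
`ℓ`. If `ℓ` is ramified or inert in `K`, `ℓ` splits completely in `K_∞`"). The anticyclotomic
replacement for Greenberg–Vatsal's `s_ℓ` (`GreenbergVatsal2000.sFactor`).
[cite: KellerYin2024, Lemma 1.0.1 and Lemma 1.1.1 (arXiv:2402.12781v2 TeX L388, L455; "γ_w the image of Frob_w in the decomposition group")]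
[cite: GreenbergVatsal2000, §2 Prop. (2.4) (p. 22) and p. 30 (s_ℓ)] -/
def numPlacesAbove (κ : ZpExtension K p) (w : HeightOneSpectrum (𝓞 K)) : ℕ :=
  ((decomp (K := K) w).map κ.toContinuousMonoidHom.toMonoidHom).index

/-- Unfolding `numPlacesAbove` (definitional). [cite: KellerYin2024, Lemma 1.1.1 (arXiv:2402.12781v2)] -/
theorem numPlacesAbove_eq (κ : ZpExtension K p) (w : HeightOneSpectrum (𝓞 K)) :
    numPlacesAbove κ w = ((decomp (K := K) w).map κ.toContinuousMonoidHom.toMonoidHom).index :=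
  rfl

end Places

/-! ## §2 `λ(𝒫_w(θ))` for a character `θ : Γ_K → GL₁(𝒪)` -/

section Character

variable {K : Type} [Field K] [NumberField K] {p : ℕ} [Fact p.Prime] (S : Set (PadicAlgCl p))
  (κ : ZpExtension K p)

/-- **"`θ` is unramified at `w` and `θ(Frob_w) ≡ Nw (mod 𝔭)`"** for a character
`θ : Γ_K → GL₁(𝒪)`, `𝒪 = 𝒪_{ℚ_p(S)} ⊆ ℚ̄_p`: `θ` is unramified at `w` (tree:
`FramedGaloisRep.IsUnramifiedAt`) and for some `a ∈ 𝒪` the characteristic polynomial of every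
ARITHMETIC Frobenius at every prime above `w` is `X − a` (tree: `FramedGaloisRep.HasFrobCharpolyAt`,
Mathlib `IsArithFrobAt`; i.e. `a = θ(Frob_w)`, KY L383 "`Frob_w` … the arithmetic Frobenius") with
`|a − Nw|_p < 1`, `Nw = #(𝓞_K/w)` (`= ℓ` at a place `w ∣ ℓ` split in `K`). This is the condition
"`X = ℓ̃⁻¹` is a root of `P̃_w(X) = 1 − θ̄(Frob_w) X`" of Greenberg–Vatsal Prop. (2.4), i.e. the
eigenvalue of Frobenius on `F(θ)` is `≡ ℓ`, under which `H¹(K_{∞,η}, (F/𝒪)(θ)) ≅ (F/𝒪)(θ)(−1)^{G} ≠ 0`.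
[cite: KellerYin2024, Lemma 1.1.1 (arXiv:2402.12781v2 TeX L455–462) with L383 (arithmetic Frobenius)]
[cite: GreenbergVatsal2000, §2 Prop. (2.4) (p. 22) (d_ℓ)] -/
def FrobActsAsNormAt (θ : FramedGaloisRep K (padicCoeffIntegers S) 1)
    (w : HeightOneSpectrum (𝓞 K)) : Prop :=
  θ.IsUnramifiedAt w ∧ ∃ a : padicCoeffIntegers S, θ.HasFrobCharpolyAt w (X - C a) ∧
    ‖(a : PadicAlgCl p) - (w.asIdeal.absNorm : PadicAlgCl p)‖ < 1

/-- **`λ(𝒫_w(θ)) ∈ ℕ`** — the `λ`-invariant of Keller–Yin's anticyclotomic local Euler factor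
`𝒫_w(θ) = P_w(ℓ⁻¹γ_w) = 1 − θ(Frob_w)ℓ⁻¹γ_w ∈ Λ` at a place `w ∣ ℓ ≠ p` split in `K`
(= the `λ`-invariant of the `Λ`-torsion module `H¹(K_w, M_θ)^∨`, KY Lemma 1.1.1 = CGLS Lemma 1.1.1):
`[Γ : Γ_w] · 𝟙[θ unramified at w ∧ θ(Frob_w) ≡ ℓ (mod 𝔭)]` (module docstring for the one-line
computation; `0` for `θ` ramified at `w`, where `F(θ)_{I_w} = 0` and `𝒫_w(θ) = 1`, as printed). The
anticyclotomic analogue of the character case of Greenberg–Vatsal's `δ = s_ℓ d_ℓ`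
(`GreenbergVatsal2000.delta`). [cite: KellerYin2024, Lemma 1.1.1 (`H1 Euler`, arXiv:2402.12781v2 TeX L455–462, p. 9)]
[cite: CastellaGrossiLeeSkinner2022, Lemma 1.1.1] [cite: GreenbergVatsal2000, §2 Prop. (2.4) (p. 22)] -/
def charLocalLambda (θ : FramedGaloisRep K (padicCoeffIntegers S) 1)
    (w : HeightOneSpectrum (𝓞 K)) : ℕ :=
  numPlacesAbove κ w * (if FrobActsAsNormAt S θ w then 1 else 0)

variable (θ : FramedGaloisRep K (padicCoeffIntegers S) 1) (w : HeightOneSpectrum (𝓞 K))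

/-- `λ(𝒫_w(θ)) = [Γ : Γ_w]` when `θ(Frob_w) ≡ ℓ (mod 𝔭)`. [cite: KellerYin2024, Lemma 1.1.1 (arXiv:2402.12781v2)] -/
theorem charLocalLambda_of_frobActsAsNormAt (h : FrobActsAsNormAt S θ w) :
    charLocalLambda S κ θ w = numPlacesAbove κ w := by
  rw [charLocalLambda, if_pos h, mul_one]

/-- `λ(𝒫_w(θ)) = 0` when `θ(Frob_w) ≢ ℓ (mod 𝔭)` (or `θ` is ramified at `w`): `𝒫_w(θ)` is then a
unit of `Λ` (resp. `= 1`). [cite: KellerYin2024, Lemma 1.1.1 (arXiv:2402.12781v2)] -/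
theorem charLocalLambda_of_not_frobActsAsNormAt (h : ¬ FrobActsAsNormAt S θ w) :
    charLocalLambda S κ θ w = 0 := by
  rw [charLocalLambda, if_neg h, mul_zero]

/-- `λ(𝒫_w(θ)) ≤ [Γ : Γ_w]` (a character has one Frobenius eigenvalue).
[cite: KellerYin2024, Lemma 1.1.1 (arXiv:2402.12781v2)] -/
theorem charLocalLambda_le : charLocalLambda S κ θ w ≤ numPlacesAbove κ w := by
  by_cases h : FrobActsAsNormAt S θ w
  · rw [charLocalLambda_of_frobActsAsNormAt S κ θ w h]
  · rw [charLocalLambda_of_not_frobActsAsNormAt S κ θ w h]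
    exact Nat.zero_le _

end Character

/-! ## §3 `λ(𝒫_w(f))` for (the newform of) an elliptic curve over `K` -/

section Curve

variable {K : Type} [Field K] [NumberField K] {p : ℕ} [Fact p.Prime] (κ : ZpExtension K p)
  (W : WeierstrassCurve K) (w : HeightOneSpectrum (𝓞 K))

/-- **`λ(𝒫_w(f)) ∈ ℕ`** for `f = f_E` of weight `2`, `E/K` given by `W` (for `E/ℚ` take
`W.baseChange K`), at a place `w ∣ ℓ ≠ p` split in `K`: the `λ`-invariant of
`𝒫_w(f) = P_w(ℓ⁻¹γ_w) ∈ Λ`, `P_w = det(1 − Frob_w X ∣ V_{f,I_w})` (KY §1.5, TeX L1337–1341; CGLS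
`𝒫_w(E)`), namely `[Γ : Γ_w] ·` (multiplicity of `X = (Nw)⁻¹ = ℓ̃⁻¹` as a root of the reduction
`P̃_w(X) ∈ 𝔽_p[X]`). Here `P_w` is Mathlib's local polynomial of `W` at `w` (`1 − a_w X + Nw X²`,
`1 ∓ X`, `1`), reduced mod `p` by the tree as `GreenbergVatsal2000.eulerFactorModP W p w`, and the
multiplicity is `Polynomial.rootMultiplicity` at `(Nw : 𝔽_p)⁻¹` — the anticyclotomic twin of
`GreenbergVatsal2000.delta = sFactor · dMultiplicity` (GV Prop. (2.4): "`d_ℓ` … the multiplicity of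
`X = ℓ̃⁻¹` as a root of `P̃_ℓ(X)`"), with `s_ℓ` replaced by `numPlacesAbove κ w`.
[cite: KellerYin2024, §1.5 (arXiv:2402.12781v2 TeX L1337–1341) and Thm. 1.5.1 (the term λ(𝒫_w(f)))]
[cite: CastellaGrossiLeeSkinner2022, Thm. 2.2.2 (the term λ(𝒫_w(E)))]
[cite: GreenbergVatsal2000, §2 Prop. (2.4) (p. 22)] -/
def curveLocalLambda : ℕ :=
  numPlacesAbove κ w *
    (GreenbergVatsal2000.eulerFactorModP W p w).rootMultiplicity ((w.asIdeal.absNorm : ZMod p)⁻¹)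

/-- Unfolding `curveLocalLambda` (definitional). [cite: KellerYin2024, §1.5 (arXiv:2402.12781v2 TeX L1337–1341)] -/
theorem curveLocalLambda_eq :
    curveLocalLambda κ W w = numPlacesAbove κ w *
      (GreenbergVatsal2000.eulerFactorModP W p w).rootMultiplicity
        ((w.asIdeal.absNorm : ZMod p)⁻¹) :=
  rfl

/-- If the reduced Euler factor does not vanish at `ℓ̃⁻¹` then `λ(𝒫_w(f)) = 0` (`𝒫_w(f)` is a unit
of `Λ`). [cite: KellerYin2024, §1.5 (arXiv:2402.12781v2)] [cite: GreenbergVatsal2000, §2 Prop. (2.4) (p. 22)] -/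
theorem curveLocalLambda_eq_zero_of_not_isRoot
    (h : ¬ (GreenbergVatsal2000.eulerFactorModP W p w).IsRoot ((w.asIdeal.absNorm : ZMod p)⁻¹)) :
    curveLocalLambda κ W w = 0 := by
  rw [curveLocalLambda, Polynomial.rootMultiplicity_eq_zero h, mul_zero]

end Curve

end Literature.NumberTheory.EllipticCurves.KellerYin2024

end
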